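import Literature.Geometry.Symplectic.FirstChernClassModTwoEqWuClassFour
import Literature.Geometry.Symplectic.DiagonalThomClassFourFibre
import Literature.Geometry.Symplectic.ComplexOrientationExists
import Literature.AlgebraicTopology.SingularHomology.CartanFormulaSqTwoDegreeFour
import Literature.AlgebraicTopology.SingularHomology.SteenrodSquareOneBockstein
import Literature.AlgebraicTopology.SingularHomology.CompactGroupExteriorCohomology
import Literature.AlgebraicTopology.SingularHomology.ProductKunnethField
import Literature.AlgebraicTopology.SingularHomology.PoincareDualityCorollaries
import Literature.AlgebraicTopology.SingularHomology.CupProductProofs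
import Literature.AlgebraicTopology.SingularHomology.CohomologyFiniteness
import Literature.AlgebraicTopology.CharacteristicClasses.ChernClassModTwoReduction
import HarnessLib

/-!
# Wu's formula `c₁(TM, J) ≡ v₂(M) (mod 2)` for closed almost complex `4`-manifolds — proof

Discharge of the named fact `firstChernClass_modTwo_eq_wuClass_almostComplex_four`
(`FirstChernClassModTwoEqWuClassFour.lean`; Milnor–Stasheff 1974, Thm. 11.14 with Problem 14-B;
McDuff–Salamon 2017, Rem. 4.1.10): for a closed connected smooth `4`-manifold `M` with an almost
complex structure `J`, the mod-2 reduction `c̄₁` of `c₁(TM, J)` is the Wu class `v₂(M)`.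

The proof is Milnor–Stasheff's proof of Thm. 11.14 (§11, p. 132: "`⟨(1 × x) ⌣ Sqᵏ u'', …⟩` computed
two ways") run directly for the complex tangent bundle in degree `2`, with every ingredient a theorem
of the tree:

* the diagonal class `U ∈ H⁴(M × M; 𝔽₂)` of the exponential tube (`DiagonalThomClassFour.lean`) with
  (S) `Sq² U = U ⌣ pr₁^* c̄₁` (Thom, `steenrodSq_two_diagClass`), (Sym) `U ⌣ pr₁^* a = U ⌣ pr₂^* a`
  (`diagClass_cup_fst_eq_snd`) and (Fib) `⟨j_x^* U, [M]₂⟩ = 1` (`DiagonalThomClassFourFibre.lean`);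
* the Cartan formula for `Sq²` in total degree `4` (`CartanFormulaSqTwoDegreeFour.lean`);
* Künneth over `𝔽₂` for `M × M` (`ProductKunnethField.lean`: spanning by cross products, and
  injectivity of the Leray–Hirsch map, used only to see `H⁸(M × M; 𝔽₂) ≠ 0`);
* `Sq¹ = 0 : H³(M; 𝔽₂) → H⁴(M; 𝔽₂)` on a closed oriented `4`-manifold (`Sq¹ = ρ ∘ β̃`, `2β̃ = 0`,
  `H⁴(M; ℤ) ≅ ℤ`), `H⁰ = 𝔽₂ · 1`, `H⁴(M; 𝔽₂) = 𝔽₂ · ω`, `Hᵏ = 0` for `k > 4`.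

Writing `×` for cross products and `Ω = ω × ω ≠ 0` (`⟨ω, [M]₂⟩ = 1`), the computation is:
(†) `(x × 1) ⌣ Sq² z = (x × 1) ⌣ z ⌣ (1 × v₂)` for all `z ∈ H⁴(M × M)`, `x ∈ H²(M)` (Cartan on cross
products `a × b`; the bidegree-`(2,2)` survivor `(x ⌣ a) × b²` equals `(x ⌣ a) × (b ⌣ v₂)` by the
definition of `v₂`, the `(1,3)` survivor `(x ⌣ Sq¹a) × Sq¹b` dies by `Sq¹ H³ = 0`, everything else lands
in `H⁵`, `H⁶(M) = 0`); (★) `(x × 1) ⌣ U ⌣ (1 × y) = ⟨x ⌣ y, [M]₂⟩ Ω` (by (Sym) the left side is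
`((x ⌣ y) × 1) ⌣ U`, and `(w × 1) ⌣ U = ⟨w, [M]₂⟩ Ω` for `w ∈ H⁴(M)` by expanding `U` in cross products
and (Fib)); with (S) and (Sym), (†) at `z = U` reads `(x × 1) ⌣ U ⌣ (1 × c̄₁) = (x × 1) ⌣ U ⌣ (1 × v₂)`,
so `⟨x ⌣ c̄₁, [M]₂⟩ = ⟨x ⌣ v₂, [M]₂⟩ = ⟨Sq² x, [M]₂⟩` for all `x`, i.e. `c̄₁ = v₂`
(`eq_wuClass_of_forall`).  No named facts are introduced (D-0026).

## References

* J. Milnor, J. Stasheff, *Characteristic Classes*, Ann. of Math. Stud. 76 (1974), §11 Thm. 11.14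
  (proof, p. 132), Lemma 11.8–11.9, §8 Thm. 8.1, Problem 14-B. [MilnorStasheff1974]
* D. McDuff, D. Salamon, *Introduction to Symplectic Topology*, 3rd ed., OUP (2017), Rem. 4.1.10
  (pp. 161–162). [McDuffSalamon2017]
* A. Hatcher, *Algebraic Topology*, CUP 2002, §3.2 Thm. 3.16, §3.3 Thm. 3.30, §3.E p. 303,
  §4.L Thm. 4L.12. [HatcherAT2002]
-/

noncomputable section

open CategoryTheory Function Set
open Literature.AlgebraicTopology.SingularHomology Literature.AlgebraicTopology.CharacteristicClasses
open scoped Manifold ContDiff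

namespace Literature.Geometry.Symplectic

namespace FirstChernWuFour

/-! ### Generalities: `Hᵏ(M; 𝔽₂)` of a closed connected `4`-manifold -/

section Closed

variable {M : Type} [TopologicalSpace M] [T2Space M] [CompactSpace M] [ChartedSpace (EuclideanSpace ℝ (Fin 4)) M]

/-- `Hᵏ(M; 𝔽₂) = 0` for `k > 4` on a closed `4`-manifold. [cite: HatcherAT2002, §3.3 Thm. 3.26 (c)] -/
theorem eq_zero_of_four_lt {k : ℕ} (hk : 4 < k) (z : singularCohomology (ZMod 2) (ZMod 2) M k) : z = 0 := by
  haveI : Fact (Nat.Prime 2) := ⟨Nat.prime_two⟩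
  haveI : Subsingleton (singularHomology (ZMod 2) (ZMod 2) M k) :=
    ModuleCat.subsingleton_of_isZero
      (isZero_singularHomology_of_lt_holds (R := ZMod 2) (M := ZMod 2) (X := M) 4 hk)
  haveI : Subsingleton (singularHomology (ZMod 2) (ZMod 2) M k →ₗ[ZMod 2] ZMod 2) := inferInstance
  haveI := (kroneckerPairing_bijective_of_field (ZMod 2) M k).1.subsingleton
  exact Subsingleton.elim _ _

/-- `Hᵏ(M; 𝔽₂)` is a subsingleton for `k > 4`. [cite: HatcherAT2002, §3.3 Thm. 3.26 (c)] -/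
theorem subsingleton_of_four_lt {k : ℕ} (hk : 4 < k) : Subsingleton (singularCohomology (ZMod 2) (ZMod 2) M k) :=
  ⟨fun a b ↦ by rw [eq_zero_of_four_lt hk a, eq_zero_of_four_lt hk b]⟩

/-- `Hᵏ(M; 𝔽₂)` is finite-dimensional. [cite: HatcherAT2002, App. A Cor. A.8–A.9] -/
theorem finite_singularCohomology (k : ℕ) : Module.Finite (ZMod 2) (singularCohomology (ZMod 2) (ZMod 2) M k) :=
  haveI : Fact (Nat.Prime 2) := ⟨Nat.prime_two⟩
  finite_singularCohomology_of_compact_chartedSpace (ZMod 2) (ZMod 2) (d := 4) k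

omit [T2Space M] [CompactSpace M] [ChartedSpace (EuclideanSpace ℝ (Fin 4)) M] in
/-- A constant map kills positive-degree cohomology (it factors through a point). [cite: HatcherAT2002, §3.1 p. 199] -/
theorem map_const_eq_zero {i : ℕ} (hi : i ≠ 0) (x₀ : M) (a : singularCohomology (ZMod 2) (ZMod 2) M i) :
    singularCohomology.map (ZMod 2) (ZMod 2) (ContinuousMap.const M x₀) i a = 0 := by
  have hfac : (ContinuousMap.const M x₀ : C(M, M)) =
      (ContinuousMap.const PUnit.{1} x₀).comp (ContinuousMap.const M PUnit.unit) := rfl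
  haveI : Subsingleton (singularCohomology (ZMod 2) (ZMod 2) PUnit.{1} i) := ModuleCat.subsingleton_of_isZero
    (singularCochainComplex.isZero_singularCohomology_of_subsingleton' (R := ZMod 2) (M := ZMod 2) (X := PUnit.{1}) hi)
  rw [hfac, singularCohomology.map_comp, ModuleCat.comp_apply,
    Subsingleton.elim (singularCohomology.map (ZMod 2) (ZMod 2) (ContinuousMap.const PUnit.{1} x₀) i a) 0, map_zero]

omit [T2Space M] [CompactSpace M] [ChartedSpace (EuclideanSpace ℝ (Fin 4)) M] in
/-- Over `𝔽₂` the cup product is commutative (graded commutativity, `-1 = 1`). [cite: HatcherAT2002, §3.2 Thm. 3.11] -/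
theorem cupProduct_comm₂ {Y : Type} [TopologicalSpace Y] {p q n : ℕ} (h : p + q = n) (h' : q + p = n)
    (a : singularCohomology (ZMod 2) (ZMod 2) Y p) (b : singularCohomology (ZMod 2) (ZMod 2) Y q) :
    cupProduct h a b = cupProduct h' b a := by
  rw [cupProduct_gradedComm_holds (ZMod 2) Y h h' a b, show (-1 : ZMod 2) = 1 from by decide, one_pow, one_smul]

omit [T2Space M] [CompactSpace M] [ChartedSpace (EuclideanSpace ℝ (Fin 4)) M] in
/-- Over `𝔽₂` the Steenrod squares are linear. [cite: HatcherAT2002, §4.L p. 489] -/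
theorem steenrodSq_smul₂ {Y : Type} [TopologicalSpace Y] {p : ℕ} (i : ℕ) (c : ZMod 2)
    (z : singularCohomology (ZMod 2) (ZMod 2) Y p) : steenrodSq Y p i (c • z) = c • steenrodSq Y p i z := by
  rcases (by decide : ∀ c : ZMod 2, c = 0 ∨ c = 1) c with rfl | rfl
  · rw [zero_smul, zero_smul, map_zero]
  · rw [one_smul, one_smul]

/-- **Künneth, spanning form, for `M × M` over `𝔽₂`**: every class of `Hᵏ(M × M; 𝔽₂)` is a sum of
cross products `pr₁^* a ⌣ pr₂^* b`. [cite: HatcherAT2002, §3.2 Thm. 3.16] -/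
theorem mem_span_cross (k : ℕ) (z : singularCohomology (ZMod 2) (ZMod 2) (M × M) k) :
    z ∈ Submodule.span (ZMod 2) {v | ∃ (i j : ℕ) (h : i + j = k) (a : singularCohomology (ZMod 2) (ZMod 2) M i)
      (b : singularCohomology (ZMod 2) (ZMod 2) M j),
      v = cupProduct h (singularCohomology.map (ZMod 2) (ZMod 2) (ContinuousMap.fst : C(M × M, M)) i a)
        (singularCohomology.map (ZMod 2) (ZMod 2) (ContinuousMap.snd : C(M × M, M)) j b)} :=
  haveI : Fact (Nat.Prime 2) := ⟨Nat.prime_two⟩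
  LerayHirsch.mem_span_cupProduct_fst_snd_of_finite (ZMod 2) (EuclideanSpace ℝ (Fin 4)) (D := 4)
    finite_singularCohomology (fun _ hk ↦ subsingleton_of_four_lt hk) k z

/-! ### `Sq¹ : H³(M; 𝔽₂) → H⁴(M; 𝔽₂)` vanishes on a closed oriented `4`-manifold -/

omit [T2Space M] [CompactSpace M] [ChartedSpace (EuclideanSpace ℝ (Fin 4)) M] in
/-- Multiplication by `2` on coefficients is multiplication by `2` on `Hⁿ(X; ℤ)`. [cite: HatcherAT2002, §3.1 p. 198] -/
theorem mapCoeff_lsmul_two_apply (n : ℕ) (z : singularCohomology ℤ ℤ M n) :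
    singularCohomology.mapCoeff M (LinearMap.lsmul ℤ ℤ ((2 : ℕ) : ℤ)) n z = z + z := by
  have h : singularCochainComplex.mapCoeff M (LinearMap.lsmul ℤ ℤ ((2 : ℕ) : ℤ)) = 𝟙 _ + 𝟙 _ := by
    ext n φ σ
    simp [two_mul]
    rfl
  change (HomologicalComplex.homologyMap (singularCochainComplex.mapCoeff M (LinearMap.lsmul ℤ ℤ ((2 : ℕ) : ℤ))) n) z = z + z
  rw [h, HomologicalComplex.homologyMap_add, HomologicalComplex.homologyMap_id]
  rfl

/-- **`Sq¹ = 0 : H³(M; 𝔽₂) → H⁴(M; 𝔽₂)` on a closed connected oriented `4`-manifold**: `Sq¹ = ρ ∘ β̃`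
with `β̃` the integral Bockstein, `2 β̃ = 0`, and `H⁴(M; ℤ) ≅ ℤ` is torsion-free.
[cite: HatcherAT2002, §3.E p. 303 and §4.L Thm. 4L.12; §3.3 Thm. 3.30] -/
theorem steenrodSq_one_deg_three_eq_zero [ConnectedSpace M] (μ : HomologicalOrientation ℤ M 4)
    (b : singularCohomology (ZMod 2) (ZMod 2) M 3) : steenrodSq M 3 1 b = 0 := by
  rw [steenrodSq_one_eq_bocksteinModTwo]
  change singularCohomology.ringChange (Int.castRingHom (ZMod 2)) M 4
    (integralBockstein M 2 3 (singularCohomology.scalarChange (ZMod 2) ℤ (ZMod 2) M 3 b)) = 0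
  set y := integralBockstein M 2 3 (singularCohomology.scalarChange (ZMod 2) ℤ (ZMod 2) M 3 b) with hy
  have h2 : singularCohomology.mapCoeff M (LinearMap.lsmul ℤ ℤ ((2 : ℕ) : ℤ)) (3 + 1) y = 0 := by
    rw [hy, ← ModuleCat.comp_apply, integralBockstein_comp_lsmul]
    rfl
  rw [mapCoeff_lsmul_two_apply] at h2
  obtain ⟨ε⟩ := nonempty_singularCohomology_top_equiv_holds ℤ M 4 ⟨μ⟩
  have hy0 : y = 0 := by
    apply ε.injective
    have : ε y + ε y = 0 := by rw [← map_add, h2, map_zero]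
    rw [map_zero]
    omega
  rw [hy0, map_zero]

/-! ### The top class `ω` and `Ω = ω × ω ≠ 0` -/

variable [ConnectedSpace M] {om : singularCohomology (ZMod 2) (ZMod 2) M 4}
  (htop : kroneckerPairing (ZMod 2) (ZMod 2) M 4 om (modTwoFundamentalClass M 4) = 1)

omit [CompactSpace M] [ConnectedSpace M] in
include htop in
/-- `ω ≠ 0`. [folklore] -/
theorem omega_ne_zero : om ≠ 0 := by
  intro h
  rw [h, map_zero, LinearMap.zero_apply] at htop
  exact zero_ne_one htop

include htop in
/-- **`H⁴(M; 𝔽₂) = 𝔽₂ ω`**: every top class is `⟨w, [M]₂⟩ ω` (`H⁴ ≅ 𝔽₂` for a closed connected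
`4`-manifold and `⟨ω, [M]₂⟩ = 1`). [cite: HatcherAT2002, §3.3 Thm. 3.30] -/
theorem eq_kroneckerPairing_smul (w : singularCohomology (ZMod 2) (ZMod 2) M 4) :
    w = kroneckerPairing (ZMod 2) (ZMod 2) M 4 w (modTwoFundamentalClass M 4) • om := by
  haveI : Fact (Nat.Prime 2) := ⟨Nat.prime_two⟩
  obtain ⟨ε⟩ := nonempty_singularCohomology_top_equiv_holds (ZMod 2) M 4 ⟨modTwoOrientation M 4⟩
  have h1 : Module.finrank (ZMod 2) (singularCohomology (ZMod 2) (ZMod 2) M 4) = 1 := by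
    rw [ε.finrank_eq, Module.finrank_self]
  obtain ⟨c, hc⟩ := (finrank_eq_one_iff_of_nonzero' om (omega_ne_zero htop)).1 h1 w
  rw [← hc, map_smul, LinearMap.smul_apply, htop, smul_eq_mul, mul_one]

omit [T2Space M] [CompactSpace M] in
/-- `H⁰(M; 𝔽₂) = 𝔽₂ · 1` (`M` connected, hence path connected). [cite: HatcherAT2002, §3.1 p. 199] -/
theorem eq_smul_one₀ (a : singularCohomology (ZMod 2) (ZMod 2) M 0) :
    ∃ c : ZMod 2, a = c • singularCohomology.one (ZMod 2) M := by
  haveI := ChartedSpace.locallyPathConnectedSpace (EuclideanSpace ℝ (Fin 4)) M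
  haveI : PathConnectedSpace M := pathConnectedSpace_iff_connectedSpace.mpr inferInstance
  exact ⟨_, singularCohomology.eq_smul_one (ZMod 2) a⟩

include htop in
/-- Every class of `H⁸(M × M; 𝔽₂)` is a multiple of `Ω = pr₁^* ω ⌣ pr₂^* ω` (Künneth spanning: a cross
product `a × b` of total degree `8` vanishes unless both degrees are `4`). [cite: HatcherAT2002, §3.2 Thm. 3.16] -/
theorem exists_eq_smul_crossOmega (z : singularCohomology (ZMod 2) (ZMod 2) (M × M) 8) :
    ∃ c : ZMod 2, z = c • cupProduct (p := 4) (q := 4) (n := 8) rfl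
      (singularCohomology.map (ZMod 2) (ZMod 2) (ContinuousMap.fst : C(M × M, M)) 4 om)
      (singularCohomology.map (ZMod 2) (ZMod 2) (ContinuousMap.snd : C(M × M, M)) 4 om) := by
  refine Submodule.span_induction (p := fun z _ ↦ ∃ c : ZMod 2, z = c • cupProduct (p := 4) (q := 4) (n := 8) rfl
      (singularCohomology.map (ZMod 2) (ZMod 2) (ContinuousMap.fst : C(M × M, M)) 4 om)
      (singularCohomology.map (ZMod 2) (ZMod 2) (ContinuousMap.snd : C(M × M, M)) 4 om)) ?_ ⟨0, by rw [zero_smul]⟩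
    (fun _ _ _ _ ⟨c, hc⟩ ⟨d, hd⟩ ↦ ⟨c + d, by rw [hc, hd, add_smul]⟩) (fun r _ _ ⟨c, hc⟩ ↦ ⟨r * c, by rw [hc, smul_smul]⟩)
    (mem_span_cross 8 z)
  rintro _ ⟨i, j, h, a, b, rfl⟩
  rcases lt_trichotomy i 4 with hi | rfl | hi
  · rw [eq_zero_of_four_lt (by omega) b, map_zero, map_zero]
    exact ⟨0, by rw [zero_smul]⟩
  · obtain rfl : j = 4 := by omega
    refine ⟨kroneckerPairing (ZMod 2) (ZMod 2) M 4 a (modTwoFundamentalClass M 4) *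
      kroneckerPairing (ZMod 2) (ZMod 2) M 4 b (modTwoFundamentalClass M 4), ?_⟩
    conv_lhs => rw [eq_kroneckerPairing_smul htop a, eq_kroneckerPairing_smul htop b]
    simp only [map_smul, LinearMap.smul_apply, smul_smul]
    rw [mul_comm]
  · rw [eq_zero_of_four_lt hi a, map_zero, LinearMap.map_zero₂]
    exact ⟨0, by rw [zero_smul]⟩

include htop in
/-- **`Ω = ω × ω ≠ 0` in `H⁸(M × M; 𝔽₂)`**: the Leray–Hirsch/Künneth map for `pr₁ : M × M → M` is
injective on a non-trivial source (the component `H⁴(M) ∋ ω` at a degree-`4` basis index), so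
`H⁸(M × M; 𝔽₂) ≠ 0`, and it is spanned by `Ω`. [cite: HatcherAT2002, §3.2 Thm. 3.16] -/
theorem crossOmega_ne_zero :
    cupProduct (p := 4) (q := 4) (n := 8) rfl
      (singularCohomology.map (ZMod 2) (ZMod 2) (ContinuousMap.fst : C(M × M, M)) 4 om)
      (singularCohomology.map (ZMod 2) (ZMod 2) (ContinuousMap.snd : C(M × M, M)) 4 om) ≠ 0 := by
  haveI : Fact (Nat.Prime 2) := ⟨Nat.prime_two⟩
  haveI hfin : ∀ k, Module.Finite (ZMod 2) (singularCohomology (ZMod 2) (ZMod 2) M k) := finite_singularCohomology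
  let v : (k : Fin (4 + 1)) → Fin (Module.finrank (ZMod 2) (singularCohomology (ZMod 2) (ZMod 2) M k)) →
      singularCohomology (ZMod 2) (ZMod 2) M k := fun k ↦ Module.finBasis (ZMod 2) (singularCohomology (ZMod 2) (ZMod 2) M k)
  have hv : ∀ k : Fin (4 + 1), Bijective fun r : Fin (Module.finrank (ZMod 2) (singularCohomology (ZMod 2) (ZMod 2) M k)) → ZMod 2 ↦
      ∑ i, r i • v k i := by
    intro k
    have : (fun r : Fin (Module.finrank (ZMod 2) (singularCohomology (ZMod 2) (ZMod 2) M k)) → ZMod 2 ↦ ∑ i, r i • v k i) =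
        (Module.finBasis (ZMod 2) (singularCohomology (ZMod 2) (ZMod 2) M k)).equivFun.symm :=
      funext fun r ↦ ((Module.finBasis (ZMod 2) (singularCohomology (ZMod 2) (ZMod 2) M k)).equivFun_symm_apply r).symm
    rw [this]
    exact (Module.finBasis (ZMod 2) (singularCohomology (ZMod 2) (ZMod 2) M k)).equivFun.symm.bijective
  have hbij := LerayHirsch.bijective_lhMap_fst_prod (ZMod 2)
    (fun j : (Σ k : Fin (4 + 1), Fin (Module.finrank (ZMod 2) (singularCohomology (ZMod 2) (ZMod 2) M k))) ↦ (j.1 : ℕ))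
    (fun j ↦ v j.1 j.2) (EuclideanSpace ℝ (Fin 4))
    (LerayHirsch.bijective_lhMap_const_of_basis (ZMod 2) v hv fun _ hk ↦ subsingleton_of_four_lt hk) (M := M) 8
  have h0 : 0 < Module.finrank (ZMod 2) (singularCohomology (ZMod 2) (ZMod 2) M 4) :=
    Module.finrank_pos_iff_exists_ne_zero.2 ⟨om, omega_ne_zero htop⟩
  let j₀ : LerayHirsch.Idx
      (fun j : (Σ k : Fin (4 + 1), Fin (Module.finrank (ZMod 2) (singularCohomology (ZMod 2) (ZMod 2) M k))) ↦ (j.1 : ℕ)) 8 :=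
    ⟨⟨4, ⟨0, h0⟩⟩, show ((4 : Fin (4 + 1)) : ℕ) ≤ 8 by decide⟩
  haveI : Nontrivial (singularCohomology (ZMod 2) (ZMod 2) M (8 - ((4 : Fin (4 + 1)) : ℕ))) :=
    nontrivial_of_ne om 0 (omega_ne_zero htop)
  haveI : Nontrivial (LerayHirsch.Src (ZMod 2)
      (fun j : (Σ k : Fin (4 + 1), Fin (Module.finrank (ZMod 2) (singularCohomology (ZMod 2) (ZMod 2) M k))) ↦ (j.1 : ℕ)) M 8) :=
    Pi.nontrivial_at j₀
  haveI : Nontrivial (singularCohomology (ZMod 2) (ZMod 2) (M × M) 8) := hbij.1.nontrivial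
  obtain ⟨z, hz⟩ := exists_ne (0 : singularCohomology (ZMod 2) (ZMod 2) (M × M) 8)
  obtain ⟨c, rfl⟩ := exists_eq_smul_crossOmega htop z
  intro h
  exact hz (by rw [h, smul_zero])

/-! ### Cross product calculus on `M × M` -/

omit [T2Space M] [CompactSpace M] [ChartedSpace (EuclideanSpace ℝ (Fin 4)) M] [ConnectedSpace M] in
/-- `(x × 1) ⌣ (a × b) = ((x ⌣ a) × b)`. [cite: HatcherAT2002, §3.2 p. 215] -/
theorem fst_cup_cross {i p q m n s : ℕ} (hpq : p + q = m) (him : i + m = s) (hip : i + p = n) (hnq : n + q = s)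
    (x : singularCohomology (ZMod 2) (ZMod 2) M i) (a : singularCohomology (ZMod 2) (ZMod 2) M p) (b : singularCohomology (ZMod 2) (ZMod 2) M q) :
    cupProduct him (singularCohomology.map (ZMod 2) (ZMod 2) (ContinuousMap.fst : C(M × M, M)) i x) (cupProduct hpq (singularCohomology.map (ZMod 2) (ZMod 2) (ContinuousMap.fst : C(M × M, M)) p a) (singularCohomology.map (ZMod 2) (ZMod 2) (ContinuousMap.snd : C(M × M, M)) q b)) =
      cupProduct hnq (singularCohomology.map (ZMod 2) (ZMod 2) (ContinuousMap.fst : C(M × M, M)) n (cupProduct hip x a)) (singularCohomology.map (ZMod 2) (ZMod 2) (ContinuousMap.snd : C(M × M, M)) q b) := by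
  rw [← cupProduct_assoc hip hpq hnq him, ← cupProduct_map]

omit [T2Space M] [CompactSpace M] [ChartedSpace (EuclideanSpace ℝ (Fin 4)) M] [ConnectedSpace M] in
/-- `(a × b) ⌣ (1 × y) = (a × (b ⌣ y))`. [cite: HatcherAT2002, §3.2 p. 215] -/
theorem cross_cup_snd {p q m j s r : ℕ} (hpq : p + q = m) (hmj : m + j = s) (hqj : q + j = r) (hpr : p + r = s)
    (a : singularCohomology (ZMod 2) (ZMod 2) M p) (b : singularCohomology (ZMod 2) (ZMod 2) M q) (y : singularCohomology (ZMod 2) (ZMod 2) M j) :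
    cupProduct hmj (cupProduct hpq (singularCohomology.map (ZMod 2) (ZMod 2) (ContinuousMap.fst : C(M × M, M)) p a) (singularCohomology.map (ZMod 2) (ZMod 2) (ContinuousMap.snd : C(M × M, M)) q b)) (singularCohomology.map (ZMod 2) (ZMod 2) (ContinuousMap.snd : C(M × M, M)) j y) =
      cupProduct hpr (singularCohomology.map (ZMod 2) (ZMod 2) (ContinuousMap.fst : C(M × M, M)) p a) (singularCohomology.map (ZMod 2) (ZMod 2) (ContinuousMap.snd : C(M × M, M)) r (cupProduct hqj b y)) := by
  rw [cupProduct_assoc hpq hqj hmj hpr, ← cupProduct_map]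

omit [T2Space M] [CompactSpace M] [ChartedSpace (EuclideanSpace ℝ (Fin 4)) M] [ConnectedSpace M] in
/-- `(c • 1) × b = c • (1 × b)`. [cite: HatcherAT2002, §3.2 p. 215] -/
theorem cross_smul_one_left {q : ℕ} (h : 0 + q = q) (c : ZMod 2) (b : singularCohomology (ZMod 2) (ZMod 2) M q) :
    cupProduct h (singularCohomology.map (ZMod 2) (ZMod 2) (ContinuousMap.fst : C(M × M, M)) 0 (c • singularCohomology.one (ZMod 2) M)) (singularCohomology.map (ZMod 2) (ZMod 2) (ContinuousMap.snd : C(M × M, M)) q b) = c • singularCohomology.map (ZMod 2) (ZMod 2) (ContinuousMap.snd : C(M × M, M)) q b := by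
  rw [map_smul, singularCohomology.map_one, map_smul, LinearMap.smul_apply, one_cupProduct' (ZMod 2) h]

omit [T2Space M] [CompactSpace M] [ChartedSpace (EuclideanSpace ℝ (Fin 4)) M] [ConnectedSpace M] in
/-- `a × (c • 1) = c • (a × 1)`. [cite: HatcherAT2002, §3.2 p. 215] -/
theorem cross_smul_one_right {p : ℕ} (h : p + 0 = p) (c : ZMod 2) (a : singularCohomology (ZMod 2) (ZMod 2) M p) :
    cupProduct h (singularCohomology.map (ZMod 2) (ZMod 2) (ContinuousMap.fst : C(M × M, M)) p a) (singularCohomology.map (ZMod 2) (ZMod 2) (ContinuousMap.snd : C(M × M, M)) 0 (c • singularCohomology.one (ZMod 2) M)) = c • singularCohomology.map (ZMod 2) (ZMod 2) (ContinuousMap.fst : C(M × M, M)) p a := by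
  rw [map_smul, singularCohomology.map_one, map_smul, cupProduct_one' (ZMod 2) h]

omit [T2Space M] [CompactSpace M] [ChartedSpace (EuclideanSpace ℝ (Fin 4)) M] [ConnectedSpace M] in
/-- `j_{x₀}^*(a × b) = 0` when `deg a > 0` (`pr₁ ∘ j_{x₀}` is constant). [cite: MilnorStasheff1974, §11 Lemma 11.8] -/
theorem map_sliceMap_cross_eq_zero (x₀ : M) {i j k : ℕ} (hi : i ≠ 0) (h : i + j = k) (a : singularCohomology (ZMod 2) (ZMod 2) M i) (b : singularCohomology (ZMod 2) (ZMod 2) M j) :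
    singularCohomology.map (ZMod 2) (ZMod 2) (AlmostComplexStructure.sliceMap x₀) k (cupProduct h (singularCohomology.map (ZMod 2) (ZMod 2) (ContinuousMap.fst : C(M × M, M)) i a) (singularCohomology.map (ZMod 2) (ZMod 2) (ContinuousMap.snd : C(M × M, M)) j b)) = 0 := by
  rw [cupProduct_map, ← ModuleCat.comp_apply, ← singularCohomology.map_comp,
    show (ContinuousMap.fst : C(M × M, M)).comp (AlmostComplexStructure.sliceMap x₀) = ContinuousMap.const M x₀ from rfl,
    map_const_eq_zero hi, LinearMap.map_zero₂]

omit [T2Space M] [CompactSpace M] [ChartedSpace (EuclideanSpace ℝ (Fin 4)) M] [ConnectedSpace M] in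
/-- `j_{x₀}^*(1 × b) = b`. [cite: MilnorStasheff1974, §11 Lemma 11.8] -/
theorem map_sliceMap_snd (x₀ : M) {j : ℕ} (b : singularCohomology (ZMod 2) (ZMod 2) M j) :
    singularCohomology.map (ZMod 2) (ZMod 2) (AlmostComplexStructure.sliceMap x₀) j (singularCohomology.map (ZMod 2) (ZMod 2) (ContinuousMap.snd : C(M × M, M)) j b) = b := by
  rw [← ModuleCat.comp_apply, ← singularCohomology.map_comp,
    show (ContinuousMap.snd : C(M × M, M)).comp (AlmostComplexStructure.sliceMap x₀) = ContinuousMap.id M from rfl, singularCohomology.map_id]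
  rfl

include htop in
/-- **`b ⌣ b = b ⌣ v₂` in `H⁴(M; 𝔽₂)`** for `b ∈ H²(M; 𝔽₂)`: both pair with `[M]₂` to `⟨Sq² b, [M]₂⟩`
(definition of `v₂`), and `H⁴ = 𝔽₂ ω`. [cite: MilnorStasheff1974, §11 p. 132] -/
theorem cup_self_eq_cup_wuClass (b : singularCohomology (ZMod 2) (ZMod 2) M 2) :
    cupProduct (p := 2) (q := 2) (n := 4) rfl b b = cupProduct (p := 2) (q := 2) (n := 4) rfl b (wuClass M 4 2) := by
  have h1 : kroneckerPairing (ZMod 2) (ZMod 2) M 4 (cupProduct (p := 2) (q := 2) (n := 4) rfl b b) (modTwoFundamentalClass M 4) =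
      kroneckerPairing (ZMod 2) (ZMod 2) M 4 (cupProduct (p := 2) (q := 2) (n := 4) rfl b (wuClass M 4 2)) (modTwoFundamentalClass M 4) := by
    rw [← steenrodSq_self, cupProduct_comm₂ rfl rfl b (wuClass M 4 2), kroneckerPairing_wuClass_cupProduct (rfl : 2 + 2 = 4) b]
  rw [eq_kroneckerPairing_smul htop (cupProduct (p := 2) (q := 2) (n := 4) rfl b b), h1,
    ← eq_kroneckerPairing_smul htop]

/-! ### Milnor–Stasheff's computation (proof of Thm. 11.14, degree `2`, dimension `4`) -/

include htop in
/-- **(†) `(x × 1) ⌣ Sq² z = ((x × 1) ⌣ z) ⌣ (1 × v₂)` for every `z ∈ H⁴(M × M; 𝔽₂)`, `x ∈ H²(M; 𝔽₂)`**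
on a closed connected oriented `4`-manifold: by Künneth it suffices to treat cross products
`z = a × b`; by the Cartan formula and `H⁵(M) = H⁶(M) = 0`, `Sq¹ H³(M; 𝔽₂) = 0`, the only survivor is
the bidegree-`(2,2)` term `(x ⌣ a) × (b ⌣ b) = (x ⌣ a) × (b ⌣ v₂)`.
[cite: MilnorStasheff1974, §11 proof of Thm. 11.14 (p. 132)] -/
theorem fst_cup_steenrodSq_two (μ : HomologicalOrientation ℤ M 4) (x : singularCohomology (ZMod 2) (ZMod 2) M 2) (z : singularCohomology (ZMod 2) (ZMod 2) (M × M) 4) :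
    cupProduct (p := 2) (q := 6) (n := 8) rfl (singularCohomology.map (ZMod 2) (ZMod 2) (ContinuousMap.fst : C(M × M, M)) 2 x) (steenrodSq (M × M) 4 2 z) =
      cupProduct (p := 6) (q := 2) (n := 8) rfl (cupProduct (p := 2) (q := 4) (n := 6) rfl (singularCohomology.map (ZMod 2) (ZMod 2) (ContinuousMap.fst : C(M × M, M)) 2 x) z)
        (singularCohomology.map (ZMod 2) (ZMod 2) (ContinuousMap.snd : C(M × M, M)) 2 (wuClass M 4 2)) := by
  refine Submodule.span_induction (p := fun z _ ↦
    cupProduct (p := 2) (q := 6) (n := 8) rfl (singularCohomology.map (ZMod 2) (ZMod 2) (ContinuousMap.fst : C(M × M, M)) 2 x) (steenrodSq (M × M) 4 2 z) =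
      cupProduct (p := 6) (q := 2) (n := 8) rfl (cupProduct (p := 2) (q := 4) (n := 6) rfl (singularCohomology.map (ZMod 2) (ZMod 2) (ContinuousMap.fst : C(M × M, M)) 2 x) z)
        (singularCohomology.map (ZMod 2) (ZMod 2) (ContinuousMap.snd : C(M × M, M)) 2 (wuClass M 4 2))) ?_ ?_ ?_ ?_ (mem_span_cross 4 z)
  rotate_left
  · simp only [map_zero, LinearMap.zero_apply]
  · intro z₁ z₂ _ _ h₁ h₂
    simp only [map_add, LinearMap.add_apply, h₁, h₂]
  · intro c z _ hz
    simp only [steenrodSq_smul₂, map_smul, LinearMap.smul_apply, hz]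
  rintro _ ⟨i, j, h, a, b, rfl⟩
  have hi : i ≤ 4 := by omega
  interval_cases i
  · -- bidegree (0, 4): `z = c • (1 × b)`, `Sq² b ∈ H⁶(M) = 0`, `b ⌣ v₂ ∈ H⁶(M) = 0`
    obtain rfl : j = 4 := by omega
    obtain ⟨c, rfl⟩ := eq_smul_one₀ a
    rw [cross_smul_one_left h, steenrodSq_smul₂, ← steenrodSq_map, eq_zero_of_four_lt (by norm_num) (steenrodSq M 4 2 b),
      map_zero, smul_zero, map_zero, map_smul, map_smul, LinearMap.smul_apply,
      cupProduct_assoc (rfl : 2 + 4 = 6) (rfl : 4 + 2 = 6) (rfl : 6 + 2 = 8) (rfl : 2 + 6 = 8),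
      ← cupProduct_map, eq_zero_of_four_lt (by norm_num) (cupProduct _ b (wuClass M 4 2)), map_zero, map_zero, smul_zero]
  · -- bidegree (1, 3): Cartan; `Sq¹ b = 0` (oriented), `Sq² b ∈ H⁵ = 0`; right side `b ⌣ v₂ ∈ H⁵ = 0`
    obtain rfl : j = 3 := by omega
    rw [steenrodSq_two_cupProduct_13_zmod, ← steenrodSq_map, ← steenrodSq_map, steenrodSq_one_deg_three_eq_zero μ b,
      eq_zero_of_four_lt (by norm_num) (steenrodSq M 3 2 b),
      fst_cup_cross h rfl (rfl : 2 + 1 = 3) (rfl : 3 + 3 = 6),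
      cross_cup_snd (rfl : 3 + 3 = 6) rfl (rfl : 3 + 2 = 5) (rfl : 3 + 5 = 8),
      eq_zero_of_four_lt (by norm_num) (cupProduct _ b (wuClass M 4 2))]
    simp only [map_zero, add_zero]
  · -- bidegree (2, 2): Cartan; survivors `(x ⌣ a) × (b ⌣ b)` and `(x ⌣ a) × (b ⌣ v₂)` agree
    obtain rfl : j = 2 := by omega
    rw [steenrodSq_two_cupProduct_22_zmod, ← steenrodSq_map, ← steenrodSq_map, ← cupProduct_map, ← cupProduct_map,
      map_add, map_add,
      fst_cup_cross (rfl : 4 + 2 = 6) rfl (rfl : 2 + 4 = 6) (rfl : 6 + 2 = 8),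
      fst_cup_cross (rfl : 3 + 3 = 6) rfl (rfl : 2 + 3 = 5) (rfl : 5 + 3 = 8),
      fst_cup_cross (rfl : 2 + 4 = 6) rfl (rfl : 2 + 2 = 4) (rfl : 4 + 4 = 8),
      eq_zero_of_four_lt (by norm_num) (cupProduct _ x (cupProduct _ a a)),
      eq_zero_of_four_lt (by norm_num) (cupProduct _ x (steenrodSq M 2 1 a)),
      fst_cup_cross h rfl (rfl : 2 + 2 = 4) (rfl : 4 + 2 = 6),
      cross_cup_snd (rfl : 4 + 2 = 6) rfl (rfl : 2 + 2 = 4) (rfl : 4 + 4 = 8), cup_self_eq_cup_wuClass htop b]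
    simp only [map_zero, LinearMap.zero_apply, zero_add]
  · -- bidegree (3, 1): Cartan; `Sq² a ∈ H⁵ = 0`, `x ⌣ Sq¹ a ∈ H⁶ = 0`; right side `x ⌣ a ∈ H⁵ = 0`
    obtain rfl : j = 1 := by omega
    rw [steenrodSq_two_cupProduct_31_zmod, ← steenrodSq_map, ← steenrodSq_map, ← cupProduct_map,
      eq_zero_of_four_lt (by norm_num) (steenrodSq M 3 2 a), map_add,
      fst_cup_cross (rfl : 4 + 2 = 6) rfl (rfl : 2 + 4 = 6) (rfl : 6 + 2 = 8),
      eq_zero_of_four_lt (by norm_num) (cupProduct _ x (steenrodSq M 3 1 a)),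
      fst_cup_cross h rfl (rfl : 2 + 3 = 5) (rfl : 5 + 1 = 6),
      eq_zero_of_four_lt (by norm_num) (cupProduct _ x a)]
    simp only [map_zero, LinearMap.zero_apply, zero_add]
  · -- bidegree (4, 0): `z = c • (a × 1)`, `Sq² a ∈ H⁶ = 0`, `x ⌣ a ∈ H⁶ = 0`
    obtain rfl : j = 0 := by omega
    obtain ⟨c, rfl⟩ := eq_smul_one₀ b
    rw [cross_smul_one_right h, steenrodSq_smul₂, ← steenrodSq_map, eq_zero_of_four_lt (by norm_num) (steenrodSq M 4 2 a),
      map_zero, smul_zero, map_zero, map_smul, ← cupProduct_map, eq_zero_of_four_lt (by norm_num) (cupProduct _ x a),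
      map_zero, smul_zero, LinearMap.map_zero₂]

include htop in
/-- **`(w × 1) ⌣ U = ⟨w, [M]₂⟩ ⟨j_{x₀}^* U, [M]₂⟩ Ω` for `w ∈ H⁴(M; 𝔽₂)`, `U ∈ H⁴(M × M; 𝔽₂)`**: expand `U` in
cross products `a × b`; for `deg a > 0` both sides vanish (`w ⌣ a = 0`, `j_{x₀}^*(a × b) = 0`), and for
`a = c • 1` both are `c ⟨w, [M]₂⟩ ⟨b, [M]₂⟩ Ω`. [cite: MilnorStasheff1974, §11 Lemma 11.8–11.9] -/
theorem fst_cup_eq_smul_crossOmega (x₀ : M) (w : singularCohomology (ZMod 2) (ZMod 2) M 4) (U : singularCohomology (ZMod 2) (ZMod 2) (M × M) 4) :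
    cupProduct (p := 4) (q := 4) (n := 8) rfl (singularCohomology.map (ZMod 2) (ZMod 2) (ContinuousMap.fst : C(M × M, M)) 4 w) U =
      (kroneckerPairing (ZMod 2) (ZMod 2) M 4 (w) (modTwoFundamentalClass M 4) * kroneckerPairing (ZMod 2) (ZMod 2) M 4 (singularCohomology.map (ZMod 2) (ZMod 2) (AlmostComplexStructure.sliceMap x₀) 4 U) (modTwoFundamentalClass M 4)) • cupProduct (p := 4) (q := 4) (n := 8) rfl (singularCohomology.map (ZMod 2) (ZMod 2) (ContinuousMap.fst : C(M × M, M)) 4 om) (singularCohomology.map (ZMod 2) (ZMod 2) (ContinuousMap.snd : C(M × M, M)) 4 om) := by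
  refine Submodule.span_induction (p := fun U _ ↦ cupProduct (p := 4) (q := 4) (n := 8) rfl (singularCohomology.map (ZMod 2) (ZMod 2) (ContinuousMap.fst : C(M × M, M)) 4 w) U =
      (kroneckerPairing (ZMod 2) (ZMod 2) M 4 (w) (modTwoFundamentalClass M 4) * kroneckerPairing (ZMod 2) (ZMod 2) M 4 (singularCohomology.map (ZMod 2) (ZMod 2) (AlmostComplexStructure.sliceMap x₀) 4 U) (modTwoFundamentalClass M 4)) • cupProduct (p := 4) (q := 4) (n := 8) rfl (singularCohomology.map (ZMod 2) (ZMod 2) (ContinuousMap.fst : C(M × M, M)) 4 om) (singularCohomology.map (ZMod 2) (ZMod 2) (ContinuousMap.snd : C(M × M, M)) 4 om)) ?_ ?_ ?_ ?_ (mem_span_cross 4 U)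
  rotate_left
  · simp only [map_zero, LinearMap.zero_apply, mul_zero, zero_smul]
  · intro z₁ z₂ _ _ h₁ h₂
    simp only [map_add, LinearMap.add_apply, h₁, h₂, mul_add, add_smul]
  · intro c z _ hz
    simp only [map_smul, LinearMap.smul_apply, hz, smul_eq_mul, smul_smul, mul_left_comm]
  rintro _ ⟨i, j, h, a, b, rfl⟩
  rcases Nat.eq_zero_or_pos i with rfl | hi
  · obtain rfl : j = 4 := by omega
    obtain ⟨c, rfl⟩ := eq_smul_one₀ a
    rw [cross_smul_one_left h, map_smul, map_smul, map_sliceMap_snd, map_smul, LinearMap.smul_apply]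
    conv_lhs => rw [eq_kroneckerPairing_smul htop w, eq_kroneckerPairing_smul htop b]
    simp only [map_smul, LinearMap.smul_apply, smul_smul, smul_eq_mul]
    congr 1
    ring
  · rw [map_sliceMap_cross_eq_zero x₀ hi.ne' h a b, map_zero, LinearMap.zero_apply, mul_zero, zero_smul,
      fst_cup_cross h rfl rfl (show (4 + i) + j = 8 by omega), eq_zero_of_four_lt (by omega) (cupProduct _ w a), map_zero,
      LinearMap.map_zero₂]

omit [T2Space M] [CompactSpace M] [ChartedSpace (EuclideanSpace ℝ (Fin 4)) M] [ConnectedSpace M] in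
/-- **`((x × 1) ⌣ U) ⌣ (1 × y) = ((x ⌣ y) × 1) ⌣ U`** when `U ⌣ (a × 1) = U ⌣ (1 × a)` for all `a`
(graded commutativity over `𝔽₂`). [cite: MilnorStasheff1974, §11 Lemma 11.8] -/
theorem fst_cup_cup_snd (U : singularCohomology (ZMod 2) (ZMod 2) (M × M) 4)
    (hSym : ∀ {k m : ℕ} (h : 4 + k = m) (a : singularCohomology (ZMod 2) (ZMod 2) M k), cupProduct h U (singularCohomology.map (ZMod 2) (ZMod 2) (ContinuousMap.fst : C(M × M, M)) k a) = cupProduct h U (singularCohomology.map (ZMod 2) (ZMod 2) (ContinuousMap.snd : C(M × M, M)) k a))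
    (x y : singularCohomology (ZMod 2) (ZMod 2) M 2) :
    cupProduct (p := 6) (q := 2) (n := 8) rfl (cupProduct (p := 2) (q := 4) (n := 6) rfl (singularCohomology.map (ZMod 2) (ZMod 2) (ContinuousMap.fst : C(M × M, M)) 2 x) U) (singularCohomology.map (ZMod 2) (ZMod 2) (ContinuousMap.snd : C(M × M, M)) 2 y) =
      cupProduct (p := 4) (q := 4) (n := 8) rfl (singularCohomology.map (ZMod 2) (ZMod 2) (ContinuousMap.fst : C(M × M, M)) 4 (cupProduct (p := 2) (q := 2) (n := 4) rfl x y)) U := by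
  rw [cupProduct_assoc (rfl : 2 + 4 = 6) (rfl : 4 + 2 = 6) (rfl : 6 + 2 = 8) (rfl : 2 + 6 = 8), ← hSym,
    cupProduct_comm₂ (rfl : 4 + 2 = 6) (rfl : 2 + 4 = 6) U,
    ← cupProduct_assoc (rfl : 2 + 2 = 4) (rfl : 2 + 4 = 6) (rfl : 4 + 4 = 8) (rfl : 2 + 6 = 8), ← cupProduct_map]

include htop in
/-- **Milnor–Stasheff Thm. 11.14 (degree `2`, dimension `4`), abstract form.** Let `U ∈ H⁴(M × M; 𝔽₂)`
satisfy (S) `Sq² U = U ⌣ (c × 1)`, (Sym) `U ⌣ (a × 1) = U ⌣ (1 × a)` and (Fib) `⟨j_{x₀}^* U, [M]₂⟩ = 1` on a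
closed connected oriented `4`-manifold. Then `c = v₂(M)`. [cite: MilnorStasheff1974, §11 Thm. 11.14] -/
theorem eq_wuClass_of_diagonal (μ : HomologicalOrientation ℤ M 4) (x₀ : M) (U : singularCohomology (ZMod 2) (ZMod 2) (M × M) 4) (c : singularCohomology (ZMod 2) (ZMod 2) M 2)
    (hS : steenrodSq (M × M) 4 2 U = cupProduct (p := 4) (q := 2) (n := 6) rfl U (singularCohomology.map (ZMod 2) (ZMod 2) (ContinuousMap.fst : C(M × M, M)) 2 c))
    (hSym : ∀ {k m : ℕ} (h : 4 + k = m) (a : singularCohomology (ZMod 2) (ZMod 2) M k), cupProduct h U (singularCohomology.map (ZMod 2) (ZMod 2) (ContinuousMap.fst : C(M × M, M)) k a) = cupProduct h U (singularCohomology.map (ZMod 2) (ZMod 2) (ContinuousMap.snd : C(M × M, M)) k a))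
    (hFib : kroneckerPairing (ZMod 2) (ZMod 2) M 4 (singularCohomology.map (ZMod 2) (ZMod 2) (AlmostComplexStructure.sliceMap x₀) 4 U) (modTwoFundamentalClass M 4) = 1) :
    c = wuClass M 4 2 := by
  have key : ∀ x : singularCohomology (ZMod 2) (ZMod 2) M 2, kroneckerPairing (ZMod 2) (ZMod 2) M 4 (cupProduct (p := 2) (q := 2) (n := 4) rfl x (wuClass M 4 2)) (modTwoFundamentalClass M 4) =
      kroneckerPairing (ZMod 2) (ZMod 2) M 4 (cupProduct (p := 2) (q := 2) (n := 4) rfl x c) (modTwoFundamentalClass M 4) := by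
    intro x
    have h1 := fst_cup_steenrodSq_two htop μ x U
    rw [fst_cup_cup_snd U hSym, fst_cup_eq_smul_crossOmega htop x₀, hFib, mul_one] at h1
    rw [hS, hSym, ← cupProduct_assoc (rfl : 2 + 4 = 6) (rfl : 4 + 2 = 6) (rfl : 6 + 2 = 8) (rfl : 2 + 6 = 8),
      fst_cup_cup_snd U hSym, fst_cup_eq_smul_crossOmega htop x₀, hFib, mul_one] at h1
    exact (smul_left_injective (ZMod 2) (crossOmega_ne_zero htop) h1).symm
  refine eq_wuClass_of_forall (rfl : 2 + 2 = 4) fun x ↦ ?_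
  rw [cupProduct_comm₂ rfl rfl c x, ← key x, cupProduct_comm₂ rfl rfl x (wuClass M 4 2),
    kroneckerPairing_wuClass_cupProduct (rfl : 2 + 2 = 4) x]

end Closed

/-! ### The theorem -/

/-- **`c̄₁(TM, J) = v₂(M)`** for a closed connected almost complex `4`-manifold: the diagonal class of
the exponential tube has (S), (Sym), (Fib). [cite: MilnorStasheff1974, §11 Thm. 11.14 and Problem 14-B] -/
theorem cbarOne_eq_wuClass {M : Type} [TopologicalSpace M] [T2Space M] [CompactSpace M] [ConnectedSpace M]
    [ChartedSpace (EuclideanSpace ℝ (Fin 4)) M] [IsManifold (𝓡 4) ∞ M] (J : AlmostComplexStructure (𝓡 4) ∞ M) :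
    J.cbarOne = wuClass M 4 2 := by
  obtain ⟨ex, e, hex, he, he0, hez⟩ := AlmostComplexStructure.exists_expTube (M := M)
  have hΔ : ∀ x : M, (x, x) ∈ e.target := AlmostComplexStructure.mem_target_of_zero ex e he hez he0
  obtain ⟨x₀⟩ := (inferInstance : Nonempty M)
  exact eq_wuClass_of_diagonal (J.kroneckerPairing_map_sliceMap_diagClass_eq_one ex e he hez he0 hΔ x₀)
    J.inducedOrientation x₀ (J.diagClass ex e he hez hΔ) J.cbarOne (J.steenrodSq_two_diagClass ex e he hez hΔ)
    (fun h a ↦ J.diagClass_cup_fst_eq_snd ex e he hez hΔ hex h a)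
    (J.kroneckerPairing_map_sliceMap_diagClass_eq_one ex e he hez he0 hΔ x₀)

end FirstChernWuFour

open FirstChernWuFour in
/-- **Discharge of `firstChernClass_modTwo_eq_wuClass_almostComplex_four`** (Milnor–Stasheff Thm. 11.14
with Problem 14-B; McDuff–Salamon Rem. 4.1.10): `ρ₂ c₁(TM, J) = v₂(M)` for every closed connected almost
complex `4`-manifold. [cite: MilnorStasheff1974, Thm. 11.14 and Problem 14-B] [cite: McDuffSalamon2017, Rem. 4.1.10] -/
theorem firstChernClass_modTwo_eq_wuClass_almostComplex_four_holds :
    firstChernClass_modTwo_eq_wuClass_almostComplex_four := by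
  intro M _ _ _ _ _ _ _ J
  change singularCohomology.ringChange (algebraMap ℤ (ZMod 2)) M 2
    (degCast ℤ (mul_one 2) (chernClassZ J.complexTangentBundle 1)) = _
  rw [ringChange_degCast, algebraMap_int_eq, chernClassZ_modTwo]
  exact cbarOne_eq_wuClass J

end Literature.Geometry.Symplectic
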